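import Summits.BirchSwinnertonDyer.BirchSwinnertonDyer.Theorems.CumulativeHeegnerLeopoldtCumulativeHeegnerInclusionAtThreeGlue
import Summits.BirchSwinnertonDyer.BirchSwinnertonDyer.Theorems.CumulativeHeegnerLeopoldtResidualSelmerFiniteAtThreeOfPrint
import Summits.BirchSwinnertonDyer.BirchSwinnertonDyer.Theorems.EisensteinPrimesResidualCharacterSelmerFiniteOfFact
import HarnessLib

/-!
# Route `CumulativeHeegnerLeopoldt`, crux K1 `CumulativeHeegnerInclusionAtThree` (stmt-BirchSwinnertonDyer-24198) BY NAME, CLOSED MODULO its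
# research child `TemperedHeegnerInclusionAtThree` (crux stmt-BirchSwinnertonDyer-26896, a HYPOTHESIS) and ONE published fact — CGLS 2022
# Prop. 1.2.5 (module clause) IN PLACE OF Prop. 14 (helper, `--supports stmt-BirchSwinnertonDyer-24198`)

Prover `leafhand-bsd-cumulativeheegnerl-1` g0 (cell `bsd-eis`). Line `birth` v5 of K1 (skeleton 59217cca7adb8cbc) composes the crux from STUB A
`stub_temperedInclusion` (= child crux 26896 VERBATIM, research) and STUB P `stub_residualCharacterSelmerFinite` (= CGLS 2022 Prop. 14, the named fact
`prop14_residualCharacterSelmer_finite` = route decl `ResidualSelmerPrintedInputAtThree` BY VALUE), through the landed glue of the rev-5 split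
(`cumulativeHeegnerLeopoldt_cumulativeHeegnerInclusionAtThreeGlue_proof`, p615902) and the landed B1P closer
(`cumulativeHeegnerLeopoldt_residualSelmerFiniteAtThreeOfPrint_proof`, p616187). Cell `bsd-eis` reads Prop. 14 IN THE KERNEL from Prop. 1.2.5's module clause
(`TeichmullerPairUnramifiedAtMult.prop14_residualCharacterSelmer_finite_of_fact`). Hence K1 BY NAME ⟸ `TemperedHeegnerInclusionAtThree` ∧
`prop125_characterGrSelmerDual_torsion_muZero_dim` — the SAME print input as conjunct 1 of crux 23970's PRINT stub ALG-PRINT, so that after this seat's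
`…AlgLambdaOfCGLS` / `…OddOfCGLS` the whole route's algebraic print ledger is {CGLS 2022 Prop. 1.2.5 (module), Cor. 1.2.6 (i), (ii)}.

HONEST FRAMING: a two-token composition of tree theorems; CONDITIONAL BY NAME on the research statement `TemperedHeegnerInclusionAtThree` (crux 26896,
OPEN — hypothesis `hA`) and on ONE published fact typed as a `Prop`; no definition, no named fact introduced, no `sorry`; the item stays OPEN
(helper; the gate records a conditional result). BSD is not proved for any curve.
References: [CastellaGrossiLeeSkinner2022] §1.2 Prop. 1.2.5, Prop. 14; tree p615902, p616187, `…ResidualCharacterSelmerFiniteOfFact`.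
-/

set_option linter.dupNamespace false
set_option autoImplicit false

noncomputable section

namespace Summit.BirchSwinnertonDyer.BirchSwinnertonDyer.Theorems.CumulativeHeegnerInclusionAtThreeOfProp125

/-- **Crux K1 `CumulativeHeegnerInclusionAtThree` (item 24198) BY NAME ⟸ its research child `TemperedHeegnerInclusionAtThree` (crux 26896, hypothesis)
∧ CGLS 2022 Prop. 1.2.5's module clause** (Prop. 14 ⟸ Prop. 1.2.5 in the kernel; glue p615902; B1P closer p616187). CONDITIONAL; the item stays open.
[cite: CastellaGrossiLeeSkinner2022, §1.2 Prop. 1.2.5, Prop. 14] -/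
theorem cumulativeHeegnerInclusionAtThree_of_tempered_of_prop125
    (hA : Summit.BirchSwinnertonDyer.BirchSwinnertonDyer.Theses.CumulativeHeegnerLeopoldt.TemperedHeegnerInclusionAtThree)
    (hprop125 : Literature.NumberTheory.EllipticCurves.CastellaGrossiLeeSkinner2022.prop125_characterGrSelmerDual_torsion_muZero_dim) :
    Summit.BirchSwinnertonDyer.BirchSwinnertonDyer.Theses.CumulativeHeegnerLeopoldt.CumulativeHeegnerInclusionAtThree :=
  cumulativeHeegnerLeopoldt_cumulativeHeegnerInclusionAtThreeGlue_proof hA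
    (TeichmullerPairUnramifiedAtMult.prop14_residualCharacterSelmer_finite_of_fact hprop125)
    cumulativeHeegnerLeopoldt_residualSelmerFiniteAtThreeOfPrint_proof

end Summit.BirchSwinnertonDyer.BirchSwinnertonDyer.Theorems.CumulativeHeegnerInclusionAtThreeOfProp125

end
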